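import Literature.Probability.Percolation.TwoClusterConditionalAssociationProofs
import Summits.CriticalPhenomena.PercolationContinuityZ3.Theorems.PercNearOneGluingNearOneGluingBhkLogSupermodular
import HarnessLib

/-!
# `NoHeavyLowerTail` (stmt-CriticalPhenomena-4575) — a TWO-SIDED van den Berg–Häggström–Kahn inequality:
# the conditional negative dependence of `C_s` and `C_t` given `{s ↮ t}` is at most `μ(s ↔ t, A, B) · μ(s ↮ t, Aᶜ, Bᶜ)`

Support file (prover prim-facecert gen 13; `--supports stmt-CriticalPhenomena-4575`).  No definitions, no named
facts, no sorries.

Bond percolation with arbitrary edge probabilities `w : Sym2 V → [0,1]` on a finite vertex type (`μ = prodBernoulli w`),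
two vertices `s, t`, `D = {s ↮ t}`, `U = Dᶜ = {s ↔ t}`, an event `A` that is INCREASING IN AND DETERMINED BY the
open edge cluster `C_s` (`ω ∈ A`, `C_s ω ⊆ C_s ω'` imply `ω' ∈ A`) and an event `B` increasing in and determined
by `C_t`.  van den Berg–Häggström–Kahn 2006 (Thm. 1.4, tree `BHK2006_twoClusterConditionalAssociation.negCorrelation`,
`setTwoClusterExchange`) say that `A, B` are negatively correlated given `D`:
`Δ* := μ(D∩A)μ(D∩B) − μ(D)μ(D∩A∩B) ≥ 0`.  This file proves the complementary UPPER bound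

  `μ(D∩A)·μ(D∩B) − μ(D)·μ(D∩A∩B) ≤ μ(U∩A∩B) · μ(D∩Aᶜ∩Bᶜ)`        (`twoClusterDeficit_le`),

equivalently, in `2 × 2` form (`twoClusterSandwich`),

  `μ(D∩A∩Bᶜ) · μ(D∩Aᶜ∩B) ≤ μ(A∩B) · μ(D∩Aᶜ∩Bᶜ)`,

to be read next to BHK's `μ(D∩A∩B)·μ(D∩Aᶜ∩Bᶜ) ≤ μ(D∩A∩Bᶜ)·μ(D∩Aᶜ∩B)`.  So, given `{s ↮ t}`,
`−Cov(1_A, 1_B | D) ≤ μ(U∩A∩B)·μ(D∩Aᶜ∩Bᶜ)/μ(D)²`: the repulsion of the two clusters is quantitatively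
controlled by the probability that they MERGE with both events occurring.  Equality holds on the two-edge star
`s – h – t` with `A = {s ↔ h}`, `B = {t ↔ h}`.

Proof (this work; elementary).  Condition on `C_s = W` (BHK's display (10) with the domain Markov property, tree
`BHK2006.sum_cond_cluster`): on `{C_s = W} ∩ D` the cluster `C_t` is `C_t(η ∖ W̄)` in fresh variables `η`, so with
`φ(W) = E[1_B(C_t(η ∖ W̄))]` one has `μ(D∩X∩B) = E[1_X 1_D φ(C_s)]` for every `C_s`-event `X`, whence
`Δ* = Σ_{ω' ∈ D∩Aᶜ} μ(ω')·[μ(D∩A)·φ(C_s ω') − μ(D∩A∩B)]`.  For EVERY `W'` the event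
`B' = {η | C_t(η ∖ W̄') ∈ B}` is increasing and contained in `B` (`C_t(η ∖ W̄') ⊆ C_t η`), so
`μ(D∩A)φ(W') − μ(D∩A∩B) ≤ μ(D∩A)φ(W') − μ(D∩A∩B') = −[μ(A∩B') − μ(A)μ(B')] + [μ(U∩A∩B') − φ(W')μ(U∩A)]`
`≤ μ(U∩A∩B) (1 − φ(W'))` by Harris (`A`, `B'` increasing) and `B' ⊆ B`; summing over `ω' ∈ D∩Aᶜ` gives
`Δ* ≤ μ(U∩A∩B) · Σ_{ω'∈D∩Aᶜ} μ(ω')(1 − φ(C_s ω')) = μ(U∩A∩B)·μ(D∩Aᶜ∩Bᶜ)`.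

Provenance: the weak form `Δ* ≤ μ(U)·μ(D ∩ {1_A = 1_B})` was found as a census-clean candidate by prim-facecert
gen 12 (memo FINDING-gen12 §8, "(S1)"); the sharp form and its proof are gen 13 (memo FINDING-gen13; numerics:
0 violations and minimum ratio bound/deficit = 1.000 over 1 069 exact small-graph instances with `|S|,|T| ≤ 2` and
general up-set events).  Not found in print (van den Berg–Häggström–Kahn 2006 Thms 1.1–2.5; Gladkov 2024).

References: J. van den Berg, O. Häggström, J. Kahn, *Some conditional correlation inequalities for percolation and
related processes*, Random Structures Algorithms 29 (2006) 417–435, Thm. 1.4/1.5 and pp. 7–8 [VandenbergHaggstromKahn2005].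
Tree: `BHK2006.weight`, `BHK2006.harris`, `BHK2006.sum_cond_cluster`, `BHK2006.integral_prodBernoulli_eq_sum`,
`BHK2006.openEdgeCluster_mono` (`ConditionalPositiveAssociationProofs.lean`, `TwoClusterConditionalAssociationProofs.lean`),
`prodBernoulli_real_eq_sum_weight_ind` (`…NearOneGluingBhkLogSupermodular.lean`).
-/

noncomputable section

namespace Summit.CriticalPhenomena.PercolationContinuityZ3.Theorems

namespace TwoClusterDeficit

open MeasureTheory Set
open Literature.Probability.LatticeModels (prodBernoulli)
open Literature.Probability.Percolation
open Literature.Probability.Percolation.BHK2006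
open DecisionTree (ind ind_of_mem ind_of_not_mem ind_nonneg)
open scoped Classical

variable {V : Type*} [Fintype V]

/-- `1_{Xᶜ} = 1 − 1_X` for the real indicator `DecisionTree.ind`. [folklore] -/
theorem ind_compl_eq {α : Type*} (X : Set α) (x : α) : ind Xᶜ x = 1 - ind X x := by
  by_cases hx : x ∈ X
  · rw [ind_of_mem hx, ind_of_not_mem (fun h : x ∈ Xᶜ => h hx)]; norm_num
  · rw [ind_of_not_mem hx, ind_of_mem (Set.mem_compl hx)]; norm_num

omit [Fintype V] in
/-- An event increasing in and determined by `C_s` is an increasing event of the configuration. [folklore] -/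
theorem ind_mono_of_cluster (s : V) {A : Set (Set (Sym2 V))}
    (hA : ∀ ⦃ω ω' : Set (Sym2 V)⦄, ω ∈ A → openEdgeCluster ω s ⊆ openEdgeCluster ω' s → ω' ∈ A) :
    Monotone (ind A) := by
  intro ω ω' hle
  by_cases hω : ω ∈ A
  · rw [ind_of_mem hω, ind_of_mem (hA hω (openEdgeCluster_mono hle s))]
  · rw [ind_of_not_mem hω]; exact ind_nonneg A ω'

/-- **The pointwise step.**  For weights `w ∈ [0,1]` of total mass one, `A` increasing-in-`C_s`, `B`
increasing-in-`C_t`, `D ⊆ {0,1}^E` arbitrary, and ANY deleted set of pairs `Z` (in the application `Z = W̄'`): with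
`g η = 1_B(η ∖ Z)` (`= 1{C_t(η ∖ Z) ∈ B}`) and `φ = E g`,
`E[1_A 1_D]·φ − E[1_A 1_B 1_D] ≤ E[1_A 1_B (1 − 1_D)]·(1 − φ)`.  [this work] -/
theorem pointwise_step {w : Sym2 V → ℝ} (hw0 : ∀ e, 0 ≤ w e) (hw1 : ∀ e, w e ≤ 1)
    (hm : ∑ ω, weight w ω = 1) (s t : V) {A B : Set (Set (Sym2 V))}
    (hA : ∀ ⦃ω ω' : Set (Sym2 V)⦄, ω ∈ A → openEdgeCluster ω s ⊆ openEdgeCluster ω' s → ω' ∈ A)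
    (hB : ∀ ⦃ω ω' : Set (Sym2 V)⦄, ω ∈ B → openEdgeCluster ω t ⊆ openEdgeCluster ω' t → ω' ∈ B)
    (D : Set (Set (Sym2 V))) (Z : Set (Sym2 V)) :
    (∑ ω, weight w ω * (ind A ω * ind D ω)) * (∑ η, weight w η * ind B (η \ Z)) -
        ∑ ω, weight w ω * (ind A ω * ind B ω * ind D ω) ≤
      (∑ ω, weight w ω * (ind A ω * ind B ω * (1 - ind D ω))) *
        (1 - ∑ η, weight w η * ind B (η \ Z)) := by
  set g : Set (Sym2 V) → ℝ := fun η => ind B (η \ Z) with hg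
  have hA_mono : Monotone (ind A) := ind_mono_of_cluster s hA
  have hB_mono : Monotone (ind B) := ind_mono_of_cluster t hB
  -- `g ≤ 1_B`, `0 ≤ g`, `g` increasing
  have hg_le : ∀ η, g η ≤ ind B η := fun η => hB_mono (Set.sdiff_subset : η \ Z ⊆ η)
  have hg0 : ∀ η, 0 ≤ g η := fun η => ind_nonneg B _
  have hg_mono : Monotone g := fun η η' h => hB_mono (Set.sdiff_subset_sdiff_left h)
  -- the sums that occur
  set φ := ∑ η, weight w η * g η with hφ
  set sA := ∑ ω, weight w ω * ind A ω with hsA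
  set sDA := ∑ ω, weight w ω * (ind A ω * ind D ω) with hsDA
  set sUA := ∑ ω, weight w ω * (ind A ω * (1 - ind D ω)) with hsUA
  set sDAB := ∑ ω, weight w ω * (ind A ω * ind B ω * ind D ω) with hsDAB
  set sUAB := ∑ ω, weight w ω * (ind A ω * ind B ω * (1 - ind D ω)) with hsUAB
  set S1 := ∑ ω, weight w ω * (ind A ω * g ω * ind D ω) with hS1
  set S2 := ∑ ω, weight w ω * (ind A ω * g ω) with hS2
  set S3 := ∑ ω, weight w ω * (ind A ω * g ω * (1 - ind D ω)) with hS3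
  -- Harris: `sA · φ ≤ S2`
  have h2 : sA * φ ≤ S2 := by
    have h := harris hw0 hw1 (f := ind A) (g := g) (fun a => ind_nonneg A a) hg0 hA_mono hg_mono
    rw [hm, one_mul] at h
    exact h
  -- `S1 ≤ sDAB` (termwise, `g ≤ 1_B`)
  have h1 : S1 ≤ sDAB :=
    Finset.sum_le_sum fun ω _ => mul_le_mul_of_nonneg_left
      (mul_le_mul_of_nonneg_right (mul_le_mul_of_nonneg_left (hg_le ω) (ind_nonneg A ω))
        (ind_nonneg D ω)) (weight_nonneg hw0 hw1 ω)
  -- `S3 ≤ sUAB` (termwise)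
  have hD1 : ∀ ω, 0 ≤ 1 - ind D ω := fun ω => sub_nonneg.2 (ind_le_one D ω)
  have h3 : S3 ≤ sUAB :=
    Finset.sum_le_sum fun ω _ => mul_le_mul_of_nonneg_left
      (mul_le_mul_of_nonneg_right (mul_le_mul_of_nonneg_left (hg_le ω) (ind_nonneg A ω))
        (hD1 ω)) (weight_nonneg hw0 hw1 ω)
  -- `sUAB ≤ sUA` (termwise, `1_B ≤ 1`)
  have h4 : sUAB ≤ sUA :=
    Finset.sum_le_sum fun ω _ => mul_le_mul_of_nonneg_left
      (mul_le_mul_of_nonneg_right (by nlinarith [ind_nonneg A ω, ind_le_one B ω, ind_nonneg B ω])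
        (hD1 ω)) (weight_nonneg hw0 hw1 ω)
  have h5 : 0 ≤ φ := Finset.sum_nonneg fun η _ => mul_nonneg (weight_nonneg hw0 hw1 η) (hg0 η)
  -- linear identities
  have e1 : sDA = sA - sUA := by
    rw [hsDA, hsA, hsUA, ← Finset.sum_sub_distrib]
    exact Finset.sum_congr rfl fun ω _ => by ring
  have e2 : S1 = S2 - S3 := by
    rw [hS1, hS2, hS3, ← Finset.sum_sub_distrib]
    exact Finset.sum_congr rfl fun ω _ => by ring
  -- conclusion
  have h45 : sUAB * φ ≤ sUA * φ := mul_le_mul_of_nonneg_right h4 h5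
  show sDA * φ - sDAB ≤ sUAB * (1 - φ)
  nlinarith [h1, h2, h3, h45, e1, e2]

/-- **The two-sided BHK inequality in finite-sum form.**  For weights `w ∈ [0,1]` of total mass one, vertices
`s, t`, `D = {s ↮ t}`, `A` increasing in and determined by `C_s`, `B` increasing in and determined by `C_t`:
`E[1_A 1_D]·E[1_B 1_D] − E[1_D]·E[1_A 1_B 1_D] ≤ E[1_A 1_B (1 − 1_D)] · E[(1 − 1_A)(1 − 1_B) 1_D]`.  [this work] -/
theorem sum_form {w : Sym2 V → ℝ} (hw0 : ∀ e, 0 ≤ w e) (hw1 : ∀ e, w e ≤ 1)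
    (hm : ∑ ω, weight w ω = 1) (s t : V) {A B : Set (Set (Sym2 V))}
    (hA : ∀ ⦃ω ω' : Set (Sym2 V)⦄, ω ∈ A → openEdgeCluster ω s ⊆ openEdgeCluster ω' s → ω' ∈ A)
    (hB : ∀ ⦃ω ω' : Set (Sym2 V)⦄, ω ∈ B → openEdgeCluster ω t ⊆ openEdgeCluster ω' t → ω' ∈ B)
    {D : Set (Set (Sym2 V))} (hD : ∀ ω, ω ∈ D ↔ ¬ (openGraph ω).Reachable s t) :
    (∑ ω, weight w ω * (ind A ω * ind D ω)) * (∑ ω, weight w ω * (ind B ω * ind D ω)) -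
        (∑ ω, weight w ω * ind D ω) * (∑ ω, weight w ω * (ind A ω * ind B ω * ind D ω)) ≤
      (∑ ω, weight w ω * (ind A ω * ind B ω * (1 - ind D ω))) *
        (∑ ω, weight w ω * ((1 - ind A ω) * (1 - ind B ω) * ind D ω)) := by
  -- the `C_s`-readable indicator of `A` and the `C_t`-readable indicator of `B`
  set a : Set (Sym2 V) → ℝ := fun C => if ∃ ω ∈ A, openEdgeCluster ω s ⊆ C then 1 else 0 with ha_def
  set b : Set (Sym2 V) → ℝ := fun E => if ∃ ω ∈ B, openEdgeCluster ω t ⊆ E then 1 else 0 with hb_def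
  have ha : ∀ ω, a (openEdgeCluster ω s) = ind A ω := by
    intro ω
    by_cases hω : ω ∈ A
    · rw [ind_of_mem hω, ha_def]
      exact if_pos ⟨ω, hω, subset_rfl⟩
    · rw [ind_of_not_mem hω, ha_def]
      exact if_neg fun ⟨ω', hω', hsub⟩ => hω (hA hω' hsub)
  have hb : ∀ ω, b (openEdgeCluster ω t) = ind B ω := by
    intro ω
    by_cases hω : ω ∈ B
    · rw [ind_of_mem hω, hb_def]
      exact if_pos ⟨ω, hω, subset_rfl⟩
    · rw [ind_of_not_mem hω, hb_def]
      exact if_neg fun ⟨ω', hω', hsub⟩ => hω (hB hω' hsub)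
  -- `φ(W) = E[1_B(η ∖ W̄)]` (`= P(C_t(η ∖ W̄) ∈ B)`, since `B` is read off `C_t`) and `Φ = φ ∘ C_s`
  set Φ : Set (Sym2 V) → ℝ := fun ω => ∑ η, weight w η *
    ind B (η \ {e | ∃ v ∈ e, v = s ∨ ∃ e' ∈ openEdgeCluster ω s, v ∈ e'}) with hΦ
  -- BHK's display (10): `E[1_B 1_D] = E[Φ 1_D]` and `E[1_A 1_B 1_D] = E[1_A Φ 1_D]`
  have eB : ∑ ω, weight w ω * (ind B ω * ind D ω) = ∑ ω, weight w ω * (Φ ω * ind D ω) := by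
    have h := sum_cond_cluster w hm s t (fun _ E => b E) hD
    simp only [hb] at h
    rw [h]
  have hpull : ∀ ω, (∑ η, weight w η *
      (ind A ω * ind B (η \ {e | ∃ v ∈ e, v = s ∨ ∃ e' ∈ openEdgeCluster ω s, v ∈ e'}))) =
      ind A ω * Φ ω := by
    intro ω
    rw [hΦ]
    simp only
    rw [Finset.mul_sum]
    exact Finset.sum_congr rfl fun η _ => by ring
  have eAB : ∑ ω, weight w ω * (ind A ω * ind B ω * ind D ω) =
      ∑ ω, weight w ω * (ind A ω * Φ ω * ind D ω) := by
    have h := sum_cond_cluster w hm s t (fun C E => a C * b E) hD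
    simp only [ha, hb] at h
    rw [h]
    exact Finset.sum_congr rfl fun ω _ => by rw [hpull]
  -- names for the sums
  set sD := ∑ ω, weight w ω * ind D ω with hsD
  set sDA := ∑ ω, weight w ω * (ind A ω * ind D ω) with hsDA
  set sDB := ∑ ω, weight w ω * (ind B ω * ind D ω) with hsDB
  set sDAB := ∑ ω, weight w ω * (ind A ω * ind B ω * ind D ω) with hsDAB
  set sUAB := ∑ ω, weight w ω * (ind A ω * ind B ω * (1 - ind D ω)) with hsUAB
  set sDAcBc := ∑ ω, weight w ω * ((1 - ind A ω) * (1 - ind B ω) * ind D ω) with hsDAcBc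
  set sDAc := ∑ ω, weight w ω * ((1 - ind A ω) * ind D ω) with hsDAc
  set R := ∑ ω, weight w ω * ((1 - ind A ω) * Φ ω * ind D ω) with hR
  -- linear identities between them
  have i1 : sD = sDA + sDAc := by
    rw [hsD, hsDA, hsDAc, ← Finset.sum_add_distrib]
    exact Finset.sum_congr rfl fun ω _ => by ring
  have i2 : sDB = sDAB + R := by
    rw [eB, eAB, hR, ← Finset.sum_add_distrib]
    exact Finset.sum_congr rfl fun ω _ => by ring
  have i3 : sDAcBc = sDAc - (sDB - sDAB) := by
    rw [hsDAcBc, hsDAc, hsDB, hsDAB, ← Finset.sum_sub_distrib, ← Finset.sum_sub_distrib]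
    exact Finset.sum_congr rfl fun ω _ => by ring
  -- the deficit as a single sum over `ω' ∈ D ∩ Aᶜ`
  have i4 : sDA * R - sDAc * sDAB =
      ∑ ω, weight w ω * ((1 - ind A ω) * ind D ω * (sDA * Φ ω - sDAB)) := by
    rw [hR, hsDAc, Finset.mul_sum, Finset.sum_mul, ← Finset.sum_sub_distrib]
    exact Finset.sum_congr rfl fun ω _ => by ring
  have i5 : ∑ ω, weight w ω * ((1 - ind A ω) * ind D ω * (sUAB * (1 - Φ ω))) =
      sUAB * (sDAc - R) := by
    rw [hR, hsDAc, mul_sub, Finset.mul_sum, Finset.mul_sum, ← Finset.sum_sub_distrib]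
    exact Finset.sum_congr rfl fun ω _ => by ring
  -- the pointwise step, at every `ω'`
  have key : ∀ ω, sDA * Φ ω - sDAB ≤ sUAB * (1 - Φ ω) := fun ω =>
    pointwise_step hw0 hw1 hm s t hA hB D
      {e | ∃ v ∈ e, v = s ∨ ∃ e' ∈ openEdgeCluster ω s, v ∈ e'}
  have hle : ∑ ω, weight w ω * ((1 - ind A ω) * ind D ω * (sDA * Φ ω - sDAB)) ≤
      ∑ ω, weight w ω * ((1 - ind A ω) * ind D ω * (sUAB * (1 - Φ ω))) :=
    Finset.sum_le_sum fun ω _ => mul_le_mul_of_nonneg_left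
      (mul_le_mul_of_nonneg_left (key ω)
        (mul_nonneg (sub_nonneg.2 (ind_le_one A ω)) (ind_nonneg D ω)))
      (weight_nonneg hw0 hw1 ω)
  rw [← i4, i5] at hle
  -- assemble
  show sDA * sDB - sD * sDAB ≤ sUAB * sDAcBc
  rw [i3, i1, i2]
  nlinarith [hle]

end TwoClusterDeficit

variable {V : Type*} [Fintype V]

open MeasureTheory Set
open Literature.Probability.LatticeModels (prodBernoulli)
open Literature.Probability.Percolation
open Literature.Probability.Percolation.BHK2006
open DecisionTree (ind ind_of_mem ind_of_not_mem ind_nonneg)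
open TwoClusterDeficit
open scoped Classical

/-- **Two-sided BHK inequality (upper bound on the two-cluster deficit).**  Bond percolation `μ = prodBernoulli w`
on a finite vertex type, vertices `s, t`, `D = {s ↮ t}`; `A` increasing in and determined by the open edge
cluster `C_s`, `B` increasing in and determined by `C_t`.  Then
`μ(D ∩ A) · μ(D ∩ B) − μ(D) · μ(D ∩ A ∩ B) ≤ μ(Dᶜ ∩ A ∩ B) · μ(D ∩ Aᶜ ∩ Bᶜ)`.
(The left-hand side is `≥ 0` by van den Berg–Häggström–Kahn 2006, Thm. 1.4.)  [this work] -/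
theorem twoClusterDeficit_le (w : Sym2 V → unitInterval) (s t : V) {A B : Set (BondConfig V)}
    (hA : ∀ ⦃ω ω' : BondConfig V⦄, ω ∈ A → openEdgeCluster ω s ⊆ openEdgeCluster ω' s → ω' ∈ A)
    (hB : ∀ ⦃ω ω' : BondConfig V⦄, ω ∈ B → openEdgeCluster ω t ⊆ openEdgeCluster ω' t → ω' ∈ B) :
    (prodBernoulli w).real ({ω : BondConfig V | ¬ (openGraph ω).Reachable s t} ∩ A) *
        (prodBernoulli w).real ({ω : BondConfig V | ¬ (openGraph ω).Reachable s t} ∩ B) -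
      (prodBernoulli w).real {ω : BondConfig V | ¬ (openGraph ω).Reachable s t} *
        (prodBernoulli w).real ({ω : BondConfig V | ¬ (openGraph ω).Reachable s t} ∩ A ∩ B) ≤
    (prodBernoulli w).real ({ω : BondConfig V | ¬ (openGraph ω).Reachable s t}ᶜ ∩ A ∩ B) *
      (prodBernoulli w).real ({ω : BondConfig V | ¬ (openGraph ω).Reachable s t} ∩ Aᶜ ∩ Bᶜ) := by
  set D : Set (BondConfig V) := {ω | ¬ (openGraph ω).Reachable s t} with hDdef
  have hD : ∀ ω, ω ∈ D ↔ ¬ (openGraph ω).Reachable s t := fun ω => by rw [hDdef]; rfl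
  set w' : Sym2 V → ℝ := fun e => (w e : ℝ) with hw'
  have hw0 : ∀ e, 0 ≤ w' e := fun e => (w e).2.1
  have hw1 : ∀ e, w' e ≤ 1 := fun e => (w e).2.2
  have hm : ∑ ω, weight w' ω = 1 := by
    have h1 := integral_prodBernoulli_eq_sum w fun _ => (1 : ℝ)
    simp only [integral_const, probReal_univ, smul_eq_mul, mul_one] at h1
    exact h1.symm
  have core := sum_form hw0 hw1 hm s t hA hB hD
  -- translate every measure into a weighted sum of products of indicators
  have r1 : (prodBernoulli w).real (D ∩ A) = ∑ ω, weight w' ω * (ind A ω * ind D ω) := by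
    rw [prodBernoulli_real_eq_sum_weight_ind]
    exact Finset.sum_congr rfl fun ω _ => by rw [ind_inter]; ring
  have r2 : (prodBernoulli w).real (D ∩ B) = ∑ ω, weight w' ω * (ind B ω * ind D ω) := by
    rw [prodBernoulli_real_eq_sum_weight_ind]
    exact Finset.sum_congr rfl fun ω _ => by rw [ind_inter]; ring
  have r3 : (prodBernoulli w).real D = ∑ ω, weight w' ω * ind D ω := prodBernoulli_real_eq_sum_weight_ind w D
  have r4 : (prodBernoulli w).real (D ∩ A ∩ B) =
      ∑ ω, weight w' ω * (ind A ω * ind B ω * ind D ω) := by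
    rw [prodBernoulli_real_eq_sum_weight_ind]
    exact Finset.sum_congr rfl fun ω _ => by rw [ind_inter, ind_inter]; ring
  have r5 : (prodBernoulli w).real (Dᶜ ∩ A ∩ B) =
      ∑ ω, weight w' ω * (ind A ω * ind B ω * (1 - ind D ω)) := by
    rw [prodBernoulli_real_eq_sum_weight_ind]
    exact Finset.sum_congr rfl fun ω _ => by rw [ind_inter, ind_inter, ind_compl_eq]; ring
  have r6 : (prodBernoulli w).real (D ∩ Aᶜ ∩ Bᶜ) =
      ∑ ω, weight w' ω * ((1 - ind A ω) * (1 - ind B ω) * ind D ω) := by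
    rw [prodBernoulli_real_eq_sum_weight_ind]
    exact Finset.sum_congr rfl fun ω _ => by rw [ind_inter, ind_inter, ind_compl_eq, ind_compl_eq]; ring
  rw [r1, r2, r3, r4, r5, r6]
  exact core

/-- **The BHK sandwich, upper half, in `2 × 2` form.**  With `D = {s ↮ t}` and `A`, `B` as in
`twoClusterDeficit_le`:  `μ(D ∩ A ∩ Bᶜ) · μ(D ∩ Aᶜ ∩ B) ≤ μ(A ∩ B) · μ(D ∩ Aᶜ ∩ Bᶜ)`
(compare BHK: `μ(D ∩ A ∩ B) · μ(D ∩ Aᶜ ∩ Bᶜ) ≤ μ(D ∩ A ∩ Bᶜ) · μ(D ∩ Aᶜ ∩ B)`).  [this work] -/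
theorem twoClusterSandwich (w : Sym2 V → unitInterval) (s t : V) {A B : Set (BondConfig V)}
    (hA : ∀ ⦃ω ω' : BondConfig V⦄, ω ∈ A → openEdgeCluster ω s ⊆ openEdgeCluster ω' s → ω' ∈ A)
    (hB : ∀ ⦃ω ω' : BondConfig V⦄, ω ∈ B → openEdgeCluster ω t ⊆ openEdgeCluster ω' t → ω' ∈ B) :
    (prodBernoulli w).real ({ω : BondConfig V | ¬ (openGraph ω).Reachable s t} ∩ A ∩ Bᶜ) *
        (prodBernoulli w).real ({ω : BondConfig V | ¬ (openGraph ω).Reachable s t} ∩ Aᶜ ∩ B) ≤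
      (prodBernoulli w).real (A ∩ B) *
        (prodBernoulli w).real ({ω : BondConfig V | ¬ (openGraph ω).Reachable s t} ∩ Aᶜ ∩ Bᶜ) := by
  set D : Set (BondConfig V) := {ω | ¬ (openGraph ω).Reachable s t} with hDdef
  have h := twoClusterDeficit_le w s t hA hB
  set w' : Sym2 V → ℝ := fun e => (w e : ℝ) with hw'
  -- atoms
  have r1 : (prodBernoulli w).real (D ∩ A) =
      (prodBernoulli w).real (D ∩ A ∩ B) + (prodBernoulli w).real (D ∩ A ∩ Bᶜ) := by
    rw [prodBernoulli_real_eq_sum_weight_ind, prodBernoulli_real_eq_sum_weight_ind, prodBernoulli_real_eq_sum_weight_ind, ← Finset.sum_add_distrib]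
    exact Finset.sum_congr rfl fun ω _ => by simp only [ind_inter, ind_compl_eq]; ring
  have r2 : (prodBernoulli w).real (D ∩ B) =
      (prodBernoulli w).real (D ∩ A ∩ B) + (prodBernoulli w).real (D ∩ Aᶜ ∩ B) := by
    rw [prodBernoulli_real_eq_sum_weight_ind, prodBernoulli_real_eq_sum_weight_ind, prodBernoulli_real_eq_sum_weight_ind, ← Finset.sum_add_distrib]
    exact Finset.sum_congr rfl fun ω _ => by simp only [ind_inter, ind_compl_eq]; ring
  have r3 : (prodBernoulli w).real D =
      (prodBernoulli w).real (D ∩ A ∩ B) + (prodBernoulli w).real (D ∩ A ∩ Bᶜ) +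
        (prodBernoulli w).real (D ∩ Aᶜ ∩ B) + (prodBernoulli w).real (D ∩ Aᶜ ∩ Bᶜ) := by
    rw [prodBernoulli_real_eq_sum_weight_ind, prodBernoulli_real_eq_sum_weight_ind, prodBernoulli_real_eq_sum_weight_ind, prodBernoulli_real_eq_sum_weight_ind, prodBernoulli_real_eq_sum_weight_ind, ← Finset.sum_add_distrib,
      ← Finset.sum_add_distrib, ← Finset.sum_add_distrib]
    exact Finset.sum_congr rfl fun ω _ => by simp only [ind_inter, ind_compl_eq]; ring
  have r4 : (prodBernoulli w).real (A ∩ B) =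
      (prodBernoulli w).real (D ∩ A ∩ B) + (prodBernoulli w).real (Dᶜ ∩ A ∩ B) := by
    rw [prodBernoulli_real_eq_sum_weight_ind, prodBernoulli_real_eq_sum_weight_ind, prodBernoulli_real_eq_sum_weight_ind, ← Finset.sum_add_distrib]
    exact Finset.sum_congr rfl fun ω _ => by simp only [ind_inter, ind_compl_eq]; ring
  rw [r1, r2, r3] at h
  rw [r4]
  nlinarith [h]

end Summit.CriticalPhenomena.PercolationContinuityZ3.Theorems
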